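import Literature.NumberTheory.Automorphic.TwistedQuotientLevelChange
import Literature.Algebra.Homology.GroupCohomologyNilpotentCoresolution
import Literature.Algebra.Homology.GroupCohomologyInvariantsNilpotent
import HarnessLib

/-!
# Level change is nilpotent-exact on Hecke algebras: operators killing `H•(X_{L'}, Ṽ)` act
# nilpotently on `H^q(X_L, Ṽ)`

Topic `NumberTheory/Automorphic`; namespace `Literature.NumberTheory.Automorphic`, grouping
sub-namespace `TwistedQuotient`.  Auxiliary definitions with bodies and theorems; no named
fact.  Assembles `TwistedQuotientLevelChange` (the `Γ × (L ⧸ L')`-representation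
`Fun(𝒢 ⧸ L', V)`, pull-back, descent, Hecke compatibilities) with the spectral-sequence-free
Hochschild–Serre nilpotence of `Literature/Algebra/Homology/GroupCohomologyNilpotentCoresolution`
(`pow_succ_map_eq_zero_of_coresolution_zero`) along the `H`-cochain coresolution of
`Literature/Algebra/Homology/GroupCohomologyInvariantsNilpotent` (`hKer_shortExact`,
`isZero_groupCohomology_twistedPi_succ`); the combination used here is re-derived below as the
private `hsNilpotent_of_free` and is the theorem `pow_succ_map_hKerRep_zero_eq_zero_of_free` of the
sibling file `GroupCohomologyInvariantsNilpotentHolds`.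

For `ι : Γ →* 𝒢`, `ρ : Γ → GL(V)`, levels `L' ≤ L ≤ 𝒢` with `L'` normal in `L`
(`W := levelProd ι hle ρ = Fun(𝒢 ⧸ L', V)` as a representation of `Γ × (L ⧸ L')`):

* `resFstIso : W|_Γ ≅ Fun(𝒢 ⧸ L', V)` (twisted coefficients of level `L'`),
  `resSndIso : W|_{L/L'} ≅ Fun(𝒢 ⧸ L', V)` as the twisted function representation of the FREE
  `L ⧸ L'`-set `𝒢 ⧸ L'` (`twistedPi`, trivial coefficients), and
  `invariantsIso : W^{L/L'} ≅ Fun(𝒢 ⧸ L, V)` (twisted coefficients of level `L`; `W^{L/L'}` is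
  `hKerRep W 0`, descent of invariant functions `levelDescend`);
* `toLevel φ'` / `toLevel' φ'`: an endomorphism `φ'` of `W` (e.g. a polynomial in Hecke
  operators `heckeProdHom`) induces endomorphisms of the level-`L` and level-`L'` coefficient
  representations; these assignments are ring homomorphisms (`toLevelRingHom`,
  `toLevel'RingHom`) sending `heckeProdHom g₀` to `heckeRepHom ι L ρ g₀`, resp.
  `heckeRepHom ι L' ρ g₀` (`toLevel_heckeProdHom`, `toLevel'_heckeProdHom`);
* **`pow_succ_map_toLevel_eq_zero`**: if `H^b(Γ, toLevel' φ') = 0` on `H^b(Γ, Fun(𝒢 ⧸ L', V))`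
  for all `b ≤ q`, then `H^q(Γ, toLevel φ')^(q+1) = 0` on `H^q(Γ, Fun(𝒢 ⧸ L, V))`.

Torsion coefficients (section `Twist`): the values may in addition be twisted by a representation
`σ` of `L ⧸ L'` commuting with `ρ` — `levelTwistRep`, `levelProdTwistRep` / `levelProdTwist`
(`((γ, h) f)(c) = ρ(γ) σ(h) f(ι(γ)⁻¹ h⁻¹ ⋆ c)`), `resFstTwistIso`, `resSndTwistIso` (now with
coefficients `Rep.of σ`), `mem_hKer_levelProdTwist_iff` (`W^{L/L'} = {f | σ(h) f(h⁻¹ ⋆ c) = f c}`),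
`heckeProdTwistHom`, `toLevelTwist'` (+ `RingHom`, `toLevelTwist'_heckeProdTwistHom`),
`val_φZ_hom_apply`, and **`pow_succ_map_φZ_levelProdTwist_eq_zero`**: if `H^b(Γ, toLevelTwist' φ')`
vanishes for `b ≤ q` then `H^q(Γ, φZ _ φ' 0)^(q+1) = 0` on `H^q(Γ, W^{L/L'})`.  This is the form
needed for `ℳ_ξ/p^m` in [Scholze2015, §V.4, proof of Thm. V.4.1], where `ℳ_{ξ,K'}/p^m` is trivial
on `X_{K'}` but `K/K'` acts on `Hʲ(X_{K'}, ℤ/p^m) ⊗ M_ξ/p^m` diagonally.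

This is the level-reduction step of [Scholze2015, §V.4, proof of Thm. V.4.1] ("One has the
Hochschild–Serre spectral sequence `Hⁱ(K/K', Hʲ(X_{K'}, M/p^m)) ⇒ H^{i+j}(X_K, M/p^m)`.  This
reduces us to the case that `K` is sufficiently small"): the kernel of
`𝕋(K', ·) → 𝕋(K, ·)` on the abstract Hecke algebra is nilpotent of order `≤ q + 1` in degree `q`.

## References

* P. Scholze, *On torsion in the cohomology of locally symmetric varieties*, Ann. of Math. 182
  (2015), §V.4, proof of Thm. V.4.1 [Scholze2015].
* M. Emerton, *On the interpolation of systems of eigenvalues attached to automorphic Hecke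
  eigenforms*, Invent. Math. 164 (2006), §2.2 [Emerton2006].
-/

noncomputable section

open CategoryTheory groupCohomology Literature.Algebra.Homology

universe u

namespace Literature.NumberTheory.Automorphic

namespace TwistedQuotient

variable {k : Type u} [CommRing k] {Γ 𝒢 : Type u} [Group Γ] [Group 𝒢]
variable (ι : Γ →* 𝒢) {L' L : Subgroup 𝒢} (hle : L' ≤ L) [hN : (L'.subgroupOf L).Normal]
variable {V : Type u} [AddCommGroup V] [Module k V] (ρ : Representation k Γ V)

/-- Hochschild–Serre nilpotence for a free `H₀`-set (the theorem
`Literature.Algebra.Homology.pow_succ_map_hKerRep_zero_eq_zero_of_free` of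
`GroupCohomologyInvariantsNilpotentHolds`, re-derived from the coresolution lemmas so that
this file only depends on `GroupCohomologyNilpotentCoresolution` and
`GroupCohomologyInvariantsNilpotent`):
if `W|_{H₀} ≅ Fun(S, N)` for a free `H₀`-set `S` and `Hᵇ(Γ, φ|_Γ) = 0` for `b ≤ q`, then
`H^q(Γ, φZ W φ 0)^(q+1) = 0` on `H^q(Γ, W^{H₀})`. [cite: Scholze2015, §V.4, proof of Thm. V.4.1] -/
private theorem hsNilpotent_of_free {H₀ : Type u} [Group H₀] (W : Rep.{u} k (Γ × H₀)) (φ : W ⟶ W)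
    {S : Type u} [MulAction H₀ S]
    (hfree : ∀ (h : H₀) (s : S), h • s = s → h = 1) (N : Rep.{u} k H₀)
    (e : resSnd W ≅ twistedPi S N) (q : ℕ)
    (hφ : ∀ b ≤ q,
      groupCohomology.map (A := resFst W) (MonoidHom.id Γ) (resFstMap W φ) b = 0) :
    (groupCohomology.map (A := hKerRep W 0) (MonoidHom.id Γ) (φZ W φ 0) q).hom ^ (q + 1) = 0 :=
  pow_succ_map_eq_zero_of_coresolution_zero (hKerRep W) (hCochainsRep W) (hι W) (hπ W)
    (hι_hπ W) (fun a => hKer_shortExact W a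
      ((isZero_groupCohomology_twistedPi_succ S N hfree a).of_iso
        ((groupCohomology.functor k H₀ (a + 1)).mapIso e))) (φZ W φ) (φC W φ) (φZ_hι W φ)
    (φC_hπ W φ) q fun a b hab =>
      map_piConstHom_eq_zero (Fin a → H₀) (resFst W) (resFstMap W φ) b (hφ b (by omega))

/-- `W = Fun(𝒢 ⧸ L', V)` as an object of `Rep k (Γ × (L ⧸ L'))`. [folklore] -/
abbrev levelProd : Rep k (Γ × (L ⧸ L'.subgroupOf L)) :=
  Rep.of (levelProdRep ι hle ρ)

/-! ### The three identifications -/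

/-- **`W|_Γ ≅ Fun(𝒢 ⧸ L', V)`**, the twisted coefficient representation of level `L'` (identity
on functions). [folklore] -/
def resFstIso : resFst (levelProd ι hle ρ) ≅ coeffRep ι L' ρ :=
  Rep.mkIso (Representation.Equiv.mk (LinearEquiv.refl k _) fun γ => LinearMap.ext fun f => by
    change levelProdRep ι hle ρ (MonoidHom.inl _ _ γ) f = coeffRepresentation ι L' ρ γ f
    rw [levelProdRep_inl])

/-- Unfolding lemma: `resFstIso` is the identity on functions. [folklore] -/
@[simp]
theorem resFstIso_hom_hom_apply (f : (𝒢 ⧸ L') → V) : (resFstIso ι hle ρ).hom.hom f = f :=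
  rfl

/-- Unfolding lemma: `resFstIso⁻¹` is the identity on functions. [folklore] -/
@[simp]
theorem resFstIso_inv_hom_apply (f : (𝒢 ⧸ L') → V) : (resFstIso ι hle ρ).inv.hom f = f :=
  rfl

/-- **`W|_{L/L'} ≅ Fun(𝒢 ⧸ L', V)` as the twisted function representation of the `L ⧸ L'`-set
`𝒢 ⧸ L'` with trivial coefficients** (identity on functions; the `L ⧸ L'`-action installed by
`levelQuotAction`). [folklore] -/
def resSndIso :
    letI := levelQuotAction hle
    resSnd (levelProd ι hle ρ) ≅ twistedPi (𝒢 ⧸ L') (Rep.trivial k (L ⧸ L'.subgroupOf L) V) :=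
  letI := levelQuotAction hle
  Rep.mkIso (Representation.Equiv.mk (LinearEquiv.refl k _) fun h =>
    LinearMap.ext fun f => funext fun c => by
      change levelProdRep ι hle ρ (MonoidHom.inr _ _ h) f c =
        Representation.trivial k _ V h (f (qsmul hle h⁻¹ c))
      rw [levelProdRep_inr_apply, Representation.trivial_apply])

/-- An `L ⧸ L'`-invariant `0`-cochain of `W` is an (`L ⧸ L'`-)invariant function on `𝒢 ⧸ L'`
(at any — the unique — point of `Fin 0 → L ⧸ L'`). [folklore] -/
theorem apply_qsmul (F : hKerRep (levelProd ι hle ρ) 0) (x : Fin 0 → L ⧸ L'.subgroupOf L)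
    (h : L ⧸ L'.subgroupOf L) (c : 𝒢 ⧸ L') : F.1 x (qsmul hle h c) = F.1 x c := by
  have hF : (levelProd ι hle ρ).ρ (MonoidHom.inr _ _ h⁻¹) (F.1 x) = F.1 x := by
    convert (mem_hKer_zero_iff (levelProd ι hle ρ) F.1).1 F.2 h⁻¹
  have hc := congrFun hF c
  change levelProdRep ι hle ρ (MonoidHom.inr _ _ h⁻¹) (F.1 x) c = F.1 x c at hc
  rwa [levelProdRep_inr_apply, inv_inv] at hc

/-- The `Γ`-action on `W^{L/L'}` is, on values, the level-`L'` coefficient action. [folklore] -/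
theorem val_ρ_apply (γ : Γ) (F : hKerRep (levelProd ι hle ρ) 0)
    (x : Fin 0 → L ⧸ L'.subgroupOf L) :
    ((hKerRep (levelProd ι hle ρ) 0).ρ γ F).1 x = coeffRepresentation ι L' ρ γ (F.1 x) := by
  have h := Rep.hom_comm_apply (hι (levelProd ι hle ρ) 0) γ F
  rw [hι_hom_apply, hι_hom_apply] at h
  refine (congrFun h x).trans ?_
  change piConstRep (Fin 0 → L ⧸ L'.subgroupOf L) (resFst (levelProd ι hle ρ)).ρ γ F.1 x = _
  rw [piConstRep_apply]
  change levelProdRep ι hle ρ (MonoidHom.inl _ _ γ) (F.1 x) = _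
  rw [levelProdRep_inl]

/-- An endomorphism of `W` preserves invariant functions: `φ' (f ∘ π)` is `L ⧸ L'`-invariant.
[folklore] -/
theorem apply_hom_levelPullback_qsmul (φ' : levelProd ι hle ρ ⟶ levelProd ι hle ρ)
    (f : (𝒢 ⧸ L) → V) (h : L ⧸ L'.subgroupOf L) (c : 𝒢 ⧸ L') :
    φ'.hom ((levelPullback ι hle ρ).hom f) (qsmul hle h c) =
      φ'.hom ((levelPullback ι hle ρ).hom f) c := by
  have hinv : levelProdRep ι hle ρ (MonoidHom.inr _ _ h⁻¹) ((levelPullback ι hle ρ).hom f) =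
      (levelPullback ι hle ρ).hom f := funext fun c => by
    rw [levelProdRep_inr_apply, inv_inv, qsmul_levelPullback]
  have hcomm := Rep.hom_comm_apply φ' (MonoidHom.inr _ _ h⁻¹) ((levelPullback ι hle ρ).hom f)
  rw [hinv] at hcomm
  have hc := congrFun hcomm c
  change _ = levelProdRep ι hle ρ (MonoidHom.inr _ _ h⁻¹) _ c at hc
  rw [levelProdRep_inr_apply, inv_inv] at hc
  exact hc.symm

omit [AddCommGroup V] in
/-- `levelDescend` depends only on the function. [folklore] -/
theorem levelDescend_congr {f g : (𝒢 ⧸ L') → V} (hfg : f = g)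
    (hf : ∀ (h : L ⧸ L'.subgroupOf L) (c : 𝒢 ⧸ L'), f (qsmul hle h c) = f c)
    (hg : ∀ (h : L ⧸ L'.subgroupOf L) (c : 𝒢 ⧸ L'), g (qsmul hle h c) = g c) :
    levelDescend hle f hf = levelDescend hle g hg := by
  subst hfg
  rfl

/-- The `k`-linear identification `W^{L/L'} ≃ Fun(𝒢 ⧸ L, V)`: descend the invariant function,
pull back. [folklore] -/
def invariantsLinearEquiv : hKerRep (levelProd ι hle ρ) 0 ≃ₗ[k] ((𝒢 ⧸ L) → V) where
  toFun F := levelDescend hle (F.1 default) (apply_qsmul ι hle ρ F default)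
  map_add' F G := by
    funext c
    induction c using QuotientGroup.induction_on with
    | H x => rfl
  map_smul' r F := by
    funext c
    induction c using QuotientGroup.induction_on with
    | H x => rfl
  invFun f := ⟨fun _ => (levelPullback ι hle ρ).hom f,
    (mem_hKer_zero_iff (levelProd ι hle ρ) _).2 fun h => funext fun c => by
      change levelProdRep ι hle ρ (MonoidHom.inr _ _ h) ((levelPullback ι hle ρ).hom f) c = _
      rw [levelProdRep_inr_apply, qsmul_levelPullback]⟩
  left_inv F := by
    refine Subtype.ext (funext fun i => ?_)
    obtain rfl : i = default := Subsingleton.elim _ _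
    exact levelPullback_levelDescend ι hle ρ _ _
  right_inv f := levelDescend_levelPullback ι hle ρ f _

/-- Unfolding lemma for `invariantsLinearEquiv`. [folklore] -/
theorem invariantsLinearEquiv_apply (F : hKerRep (levelProd ι hle ρ) 0) :
    invariantsLinearEquiv ι hle ρ F =
      levelDescend hle (F.1 default) (apply_qsmul ι hle ρ F default) :=
  rfl

/-- Unfolding lemma for `invariantsLinearEquiv⁻¹`. [folklore] -/
theorem invariantsLinearEquiv_symm_apply_val (f : (𝒢 ⧸ L) → V) (i : Fin 0 → L ⧸ L'.subgroupOf L) :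
    ((invariantsLinearEquiv ι hle ρ).symm f).1 i = (levelPullback ι hle ρ).hom f :=
  rfl

/-- **`W^{L/L'} ≅ Fun(𝒢 ⧸ L, V)`**, the twisted coefficient representation of level `L`: the
`L`-invariant functions on `𝒢 ⧸ L'` are the functions on `𝒢 ⧸ L`, `Γ`-equivariantly.
[cite: Scholze2015, §V.4, before Thm. V.4.1] -/
def invariantsIso : hKerRep (levelProd ι hle ρ) 0 ≅ coeffRep ι L ρ :=
  Rep.mkIso (Representation.Equiv.mk (invariantsLinearEquiv ι hle ρ) fun γ =>
    LinearMap.ext fun F => levelPullback_injective ι hle ρ (by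
      change (levelPullback ι hle ρ).hom
          (invariantsLinearEquiv ι hle ρ ((hKerRep (levelProd ι hle ρ) 0).ρ γ F)) =
        (levelPullback ι hle ρ).hom ((coeffRep ι L ρ).ρ γ (invariantsLinearEquiv ι hle ρ F))
      rw [Rep.hom_comm_apply, invariantsLinearEquiv_apply, invariantsLinearEquiv_apply,
        levelPullback_levelDescend, levelPullback_levelDescend]
      exact val_ρ_apply ι hle ρ γ F default))

/-! ### Endomorphisms of `W` at level `L` and at level `L'` -/

/-- The endomorphism of the level-`L` coefficients induced by an endomorphism `φ'` of `W`:
restrict to `W^{L/L'}` (`φZ … 0`) and transport along `invariantsIso`. [folklore] -/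
def toLevel (φ' : levelProd ι hle ρ ⟶ levelProd ι hle ρ) : coeffRep ι L ρ ⟶ coeffRep ι L ρ :=
  (invariantsIso ι hle ρ).inv ≫ φZ (levelProd ι hle ρ) φ' 0 ≫ (invariantsIso ι hle ρ).hom

/-- The endomorphism of the level-`L'` coefficients induced by `φ'`: restrict to `Γ` and
transport along `resFstIso` (the same map on functions). [folklore] -/
def toLevel' (φ' : levelProd ι hle ρ ⟶ levelProd ι hle ρ) : coeffRep ι L' ρ ⟶ coeffRep ι L' ρ :=
  (resFstIso ι hle ρ).inv ≫ resFstMap (levelProd ι hle ρ) φ' ≫ (resFstIso ι hle ρ).hom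

/-- `toLevel' φ'` is `φ'` on functions. [folklore] -/
@[simp]
theorem toLevel'_hom_apply (φ' : levelProd ι hle ρ ⟶ levelProd ι hle ρ) (f : (𝒢 ⧸ L') → V) :
    (toLevel' ι hle ρ φ').hom f = φ'.hom f :=
  rfl

/-- `toLevel φ'` on functions: pull back, apply `φ'`, descend. [folklore] -/
theorem toLevel_hom_apply (φ' : levelProd ι hle ρ ⟶ levelProd ι hle ρ) (f : (𝒢 ⧸ L) → V) :
    (toLevel ι hle ρ φ').hom f = levelDescend hle (φ'.hom ((levelPullback ι hle ρ).hom f))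
      (apply_hom_levelPullback_qsmul ι hle ρ φ' f) :=
  rfl

/-- `toLevel` is multiplicative. [folklore] -/
theorem toLevel_comp (φ' ψ' : levelProd ι hle ρ ⟶ levelProd ι hle ρ) :
    toLevel ι hle ρ (φ' ≫ ψ') = toLevel ι hle ρ φ' ≫ toLevel ι hle ρ ψ' := by
  have h : φZ (levelProd ι hle ρ) (φ' ≫ ψ') 0 =
      φZ (levelProd ι hle ρ) φ' 0 ≫ φZ (levelProd ι hle ρ) ψ' 0 :=
    Rep.hom_ext (Representation.IntertwiningMap.ext (LinearMap.ext fun _ => rfl))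
  simp only [toLevel, h, Category.assoc, Iso.hom_inv_id_assoc]

/-- `toLevel` is unital. [folklore] -/
theorem toLevel_id : toLevel ι hle ρ (𝟙 _) = 𝟙 _ := by
  have h : φZ (levelProd ι hle ρ) (𝟙 _) 0 = 𝟙 _ :=
    Rep.hom_ext (Representation.IntertwiningMap.ext (LinearMap.ext fun _ => rfl))
  simp only [toLevel, h, Category.id_comp, Iso.inv_hom_id]

/-- `toLevel` is additive. [folklore] -/
theorem toLevel_add (φ' ψ' : levelProd ι hle ρ ⟶ levelProd ι hle ρ) :
    toLevel ι hle ρ (φ' + ψ') = toLevel ι hle ρ φ' + toLevel ι hle ρ ψ' := by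
  have h : φZ (levelProd ι hle ρ) (φ' + ψ') 0 =
      φZ (levelProd ι hle ρ) φ' 0 + φZ (levelProd ι hle ρ) ψ' 0 :=
    Rep.hom_ext (Representation.IntertwiningMap.ext (LinearMap.ext fun _ => rfl))
  simp only [toLevel, h, Preadditive.add_comp, Preadditive.comp_add]

/-- `toLevel'` is multiplicative. [folklore] -/
theorem toLevel'_comp (φ' ψ' : levelProd ι hle ρ ⟶ levelProd ι hle ρ) :
    toLevel' ι hle ρ (φ' ≫ ψ') = toLevel' ι hle ρ φ' ≫ toLevel' ι hle ρ ψ' :=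
  Rep.hom_ext (Representation.IntertwiningMap.ext (LinearMap.ext fun _ => rfl))

/-- `toLevel'` is unital. [folklore] -/
theorem toLevel'_id : toLevel' ι hle ρ (𝟙 _) = 𝟙 _ :=
  Rep.hom_ext (Representation.IntertwiningMap.ext (LinearMap.ext fun _ => rfl))

/-- `toLevel'` is additive. [folklore] -/
theorem toLevel'_add (φ' ψ' : levelProd ι hle ρ ⟶ levelProd ι hle ρ) :
    toLevel' ι hle ρ (φ' + ψ') = toLevel' ι hle ρ φ' + toLevel' ι hle ρ ψ' :=
  Rep.hom_ext (Representation.IntertwiningMap.ext (LinearMap.ext fun _ => rfl))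

/-- **`toLevel` as a ring homomorphism `End(W) → End(Fun(𝒢 ⧸ L, V))`** (so that a noncommutative
polynomial in endomorphisms of `W` goes to the same polynomial in their level-`L` restrictions).
[folklore] -/
def toLevelRingHom : End (levelProd ι hle ρ) →+* End (coeffRep ι L ρ) where
  toFun := toLevel ι hle ρ
  map_one' := toLevel_id ι hle ρ
  map_mul' φ' ψ' := by
    change toLevel ι hle ρ (ψ' ≫ φ') = toLevel ι hle ρ ψ' ≫ toLevel ι hle ρ φ'
    exact toLevel_comp ι hle ρ ψ' φ'
  map_zero' := by
    have h := toLevel_add ι hle ρ 0 0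
    rw [add_zero] at h
    exact left_eq_add.1 h
  map_add' := toLevel_add ι hle ρ

/-- **`toLevel'` as a ring homomorphism `End(W) → End(Fun(𝒢 ⧸ L', V))`.** [folklore] -/
def toLevel'RingHom : End (levelProd ι hle ρ) →+* End (coeffRep ι L' ρ) where
  toFun := toLevel' ι hle ρ
  map_one' := toLevel'_id ι hle ρ
  map_mul' φ' ψ' := by
    change toLevel' ι hle ρ (ψ' ≫ φ') = toLevel' ι hle ρ ψ' ≫ toLevel' ι hle ρ φ'
    exact toLevel'_comp ι hle ρ ψ' φ'
  map_zero' := Rep.hom_ext (Representation.IntertwiningMap.ext (LinearMap.ext fun _ => rfl))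
  map_add' := toLevel'_add ι hle ρ

/-! ### Hecke operators -/

section Hecke

variable {g₀ : 𝒢} (hconj : ∀ l : L, ∃ a ∈ L', ∃ b ∈ L', (l : 𝒢) * g₀ * (l : 𝒢)⁻¹ = a * g₀ * b)
  (hfin' : (ArithmeticQuotient.doubleCosetQuot L' g₀).Finite)

/-- At level `L'`, `heckeProdHom g₀` induces the Hecke operator `[L' g₀ L']`. [folklore] -/
theorem toLevel'_heckeProdHom :
    toLevel' ι hle ρ (heckeProdHom ι hle ρ hconj hfin') = heckeRepHom ι L' ρ g₀ :=
  Rep.hom_ext (Representation.IntertwiningMap.ext (LinearMap.ext fun _ => rfl))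

/-- **At level `L`, `heckeProdHom g₀` induces the Hecke operator `[L g₀ L]`** when
`L' g₀ L' / L' → L g₀ L / L` is a bijection. [cite: ShimuraIATAF1971, Ch. 3, Prop. 3.1] -/
theorem toLevel_heckeProdHom
    (hbij : Set.BijOn (fun c => (1 : 𝒢)⁻¹ • ArithmeticQuotient.translateQuot (1 : 𝒢)
        (ArithmeticQuotient.conjInto_one_iff.2 hle) c)
      (ArithmeticQuotient.doubleCosetQuot L' g₀) (ArithmeticQuotient.doubleCosetQuot L g₀))
    (hfin : (ArithmeticQuotient.doubleCosetQuot L g₀).Finite) :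
    toLevel ι hle ρ (heckeProdHom ι hle ρ hconj hfin') = heckeRepHom ι L ρ g₀ := by
  refine Rep.hom_ext (Representation.IntertwiningMap.ext (LinearMap.ext fun f => ?_))
  change (toLevel ι hle ρ (heckeProdHom ι hle ρ hconj hfin')).hom f =
    ArithmeticQuotient.heckeFun k L g₀ V f
  rw [toLevel_hom_apply]
  have h : (heckeProdHom ι hle ρ hconj hfin').hom ((levelPullback ι hle ρ).hom f) =
      (levelPullback ι hle ρ).hom (ArithmeticQuotient.heckeFun k L g₀ V f) := by
    rw [heckeProdHom_hom_apply, heckeFun_levelPullback ι hle ρ hbij hfin]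
  rw [levelDescend_congr hle h _ fun h' c => qsmul_levelPullback ι hle ρ _ h' c,
    levelDescend_levelPullback]

end Hecke

/-! ### The nilpotence theorem -/

/-- Conjugating by a split injection commutes with powers: `(A N B)^(m+1) = A N^(m+1) B` for
`B A = 1`. [folklore] -/
theorem pow_succ_conj_eq {M N : Type*} [AddCommGroup M] [Module k M] [AddCommGroup N]
    [Module k N] (A : M →ₗ[k] N) (B : N →ₗ[k] M) (T : Module.End k M)
    (hBA : B ∘ₗ A = LinearMap.id) (m : ℕ) :
    (A ∘ₗ T ∘ₗ B) ^ (m + 1) = A ∘ₗ (T ^ (m + 1)) ∘ₗ B := by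
  induction m with
  | zero => rw [zero_add, pow_one, pow_one]
  | succ m ih =>
    rw [pow_succ, ih]
    refine LinearMap.ext fun x => ?_
    have hBA' : ∀ y, B (A y) = y := fun y => by
      rw [← LinearMap.comp_apply, hBA, LinearMap.id_apply]
    rw [Module.End.mul_apply, LinearMap.comp_apply, LinearMap.comp_apply, LinearMap.comp_apply,
      LinearMap.comp_apply, LinearMap.comp_apply, LinearMap.comp_apply, hBA',
      ← Module.End.mul_apply, ← pow_succ]

/-- **Level change is nilpotent-exact.**  Let `φ'` be an endomorphism of
`W = Fun(𝒢 ⧸ L', V) ∈ Rep k (Γ × (L ⧸ L'))` (e.g. a noncommutative polynomial in the Hecke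
operators `heckeProdHom g₀`, cf. `toLevelRingHom`, `toLevel_heckeProdHom`).  If the induced
endomorphism of the level-`L'` coefficients acts as `0` on `Hᵇ(Γ, Fun(𝒢 ⧸ L', V))` for all
`b ≤ q`, then the induced endomorphism of the level-`L` coefficients acts on
`H^q(Γ, Fun(𝒢 ⧸ L, V))` with `(q+1)`-st power zero — the Hochschild–Serre reduction of
[cite: Scholze2015, §V.4, proof of Thm. V.4.1], for stacky quotients of any level. -/
theorem pow_succ_map_toLevel_eq_zero (φ' : levelProd ι hle ρ ⟶ levelProd ι hle ρ) (q : ℕ)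
    (hφ : ∀ b ≤ q, groupCohomology.map (A := coeffRep ι L' ρ) (MonoidHom.id Γ)
      (toLevel' ι hle ρ φ') b = 0) :
    (groupCohomology.map (A := coeffRep ι L ρ) (MonoidHom.id Γ) (toLevel ι hle ρ φ') q).hom ^
      (q + 1) = 0 := by
  letI := levelQuotAction hle
  -- the hypothesis at level `L'`, transported to `W|_Γ` along `resFstIso`
  have hφ' : ∀ b ≤ q, groupCohomology.map (A := resFst (levelProd ι hle ρ)) (MonoidHom.id Γ)
      (resFstMap (levelProd ι hle ρ) φ') b = 0 := by
    intro b hb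
    have he : resFstMap (levelProd ι hle ρ) φ' =
        (resFstIso ι hle ρ).hom ≫ toLevel' ι hle ρ φ' ≫ (resFstIso ι hle ρ).inv := by
      simp only [toLevel', Category.assoc, Iso.hom_inv_id_assoc, Iso.hom_inv_id,
        Category.comp_id]
    rw [he, groupCohomology.map_id_comp, groupCohomology.map_id_comp, hφ b hb,
      Limits.zero_comp, Limits.comp_zero]
  -- Hochschild–Serre nilpotence on `W^{L/L'}` (`L ⧸ L'` acts freely on `𝒢 ⧸ L'`)
  have hZ : ((groupCohomology.functor k Γ q).map (φZ (levelProd ι hle ρ) φ' 0)).hom ^ (q + 1) =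
      0 :=
    hsNilpotent_of_free (levelProd ι hle ρ) φ' (fun h s hs => levelQuot_free hle h s hs)
      (Rep.trivial k (L ⧸ L'.subgroupOf L) V) (resSndIso ι hle ρ) q hφ'
  -- transport along `invariantsIso`
  have hBA : ((groupCohomology.functor k Γ q).map (invariantsIso ι hle ρ).inv).hom ∘ₗ
      ((groupCohomology.functor k Γ q).map (invariantsIso ι hle ρ).hom).hom = LinearMap.id := by
    rw [← ModuleCat.hom_comp, ← CategoryTheory.Functor.map_comp, Iso.hom_inv_id,
      CategoryTheory.Functor.map_id, ModuleCat.hom_id]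
  have he : ((groupCohomology.functor k Γ q).map (toLevel ι hle ρ φ')).hom =
      ((groupCohomology.functor k Γ q).map (invariantsIso ι hle ρ).hom).hom ∘ₗ
        ((groupCohomology.functor k Γ q).map (φZ (levelProd ι hle ρ) φ' 0)).hom ∘ₗ
          ((groupCohomology.functor k Γ q).map (invariantsIso ι hle ρ).inv).hom := by
    rw [toLevel, CategoryTheory.Functor.map_comp, CategoryTheory.Functor.map_comp,
      ModuleCat.hom_comp, ModuleCat.hom_comp, LinearMap.comp_assoc]
  change ((groupCohomology.functor k Γ q).map (toLevel ι hle ρ φ')).hom ^ (q + 1) = 0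
  rw [he, pow_succ_conj_eq _ _ _ hBA, hZ, LinearMap.zero_comp, LinearMap.comp_zero]


/-! ### Torsion coefficients: a commuting action `σ` of the Galois group `L ⧸ L'` on the values

For torsion coefficients the twist cannot be carried by `Γ` alone: in
[Scholze2015, §V.4, proof of Thm. V.4.1] the local system `ℳ_{ξ,K'}/p^m` on `X_{K'}` is trivial,
but `K/K'` acts on `Hʲ(X_{K'}, ℳ_{ξ,K'}/p^m) = Hʲ(X_{K'}, ℤ/p^m) ⊗ M_ξ/p^m` diagonally, through
`K → K_p → GL(M_ξ/p^m)` on the second factor.  We therefore let `L ⧸ L'` act on the values of the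
functions through a representation `σ` commuting with `ρ` (in the application `ρ = 1` and `σ` is
the reduction of the algebraic representation on a stable lattice; `σ = 1` gives back
`levelProdRep`).  The `L ⧸ L'`-invariants `W^{L/L'} = {f | σ(h) f(c h) = f(c)}` are then a
`Γ`-representation in their own right (`hKerRep _ 0`, `mem_hKer_levelProdTwist_iff`), on which an
endomorphism `φ'` of `W` acts through `φZ _ φ' 0`. -/

section Twist

variable (σ : Representation k (L ⧸ L'.subgroupOf L) V)

/-- The `σ`-twisted translation action of `L ⧸ L'` on `Fun(𝒢 ⧸ L', V)`:
`(h • f)(c) = σ(h) f(h⁻¹ ⋆ c)` (`h ⋆ xL' = x h⁻¹ L'`, `qsmul`). [folklore] -/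
def levelTwistRep : Representation k (L ⧸ L'.subgroupOf L) ((𝒢 ⧸ L') → V) where
  toFun h := (σ h).compLeft (𝒢 ⧸ L') ∘ₗ LinearMap.funLeft k V (qsmul hle h⁻¹)
  map_one' := by
    refine LinearMap.ext fun f => funext fun c => ?_
    simp [qsmul_one]
  map_mul' h h' := by
    refine LinearMap.ext fun f => funext fun c => ?_
    simp only [map_mul, mul_inv_rev, LinearMap.coe_comp, Function.comp_apply,
      LinearMap.funLeft_apply, LinearMap.compLeft_apply, Module.End.mul_apply]
    rw [qsmul_mul]

/-- Unfolding lemma for `levelTwistRep`. [folklore] -/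
@[simp]
theorem levelTwistRep_apply (h : L ⧸ L'.subgroupOf L) (f : (𝒢 ⧸ L') → V) (c : 𝒢 ⧸ L') :
    levelTwistRep hle σ h f c = σ h (f (qsmul hle h⁻¹ c)) :=
  rfl

/-- `T_g (s ∘ f) = s ∘ T_g f` for a linear map `s` of the values (a finite sum of translates).
[cite: ShimuraIATAF1971, Ch. 3, §8.3] -/
theorem heckeFun_linearMap_comp (s : V →ₗ[k] V) (g₀ : 𝒢) (f : (𝒢 ⧸ L') → V) :
    ArithmeticQuotient.heckeFun k L' g₀ V (s ∘ f) =
      s ∘ ArithmeticQuotient.heckeFun k L' g₀ V f := by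
  funext c
  rw [ArithmeticQuotient.heckeFun_apply, Function.comp_apply, ArithmeticQuotient.heckeFun_apply]
  split_ifs with h
  · rw [map_sum]
    rfl
  · exact (map_zero s).symm

variable (hc : ∀ (γ : Γ) (h : L ⧸ L'.subgroupOf L), Commute (ρ γ) (σ h))

include hc

/-- The twisted `Γ`-action (left translations and `ρ`) and the `σ`-twisted `L ⧸ L'`-action
(right translations and `σ`) commute when `ρ` and `σ` do. [folklore] -/
theorem commute_coeffRepresentation_levelTwistRep (γ : Γ) (h : L ⧸ L'.subgroupOf L) :
    Commute (coeffRepresentation ι L' ρ γ) (levelTwistRep hle σ h) := by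
  change coeffRepresentation ι L' ρ γ * levelTwistRep hle σ h =
    levelTwistRep hle σ h * coeffRepresentation ι L' ρ γ
  refine LinearMap.ext fun f => funext fun c => ?_
  change coeffRepresentation ι L' ρ γ (levelTwistRep hle σ h f) c =
    levelTwistRep hle σ h (coeffRepresentation ι L' ρ γ f) c
  rw [coeffRepresentation_apply, levelTwistRep_apply, levelTwistRep_apply,
    coeffRepresentation_apply, qsmul_smul_comm]
  exact LinearMap.congr_fun (hc γ h).eq _

/-- **`W = Fun(𝒢 ⧸ L', V)` as a representation of `Γ × (L ⧸ L')` with values twisted by `σ`**: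
`((γ, h) f)(c) = ρ(γ) σ(h) f(ι(γ)⁻¹ h⁻¹ ⋆ c)`. [cite: Scholze2015, §V.4, proof of Thm. V.4.1] -/
def levelProdTwistRep : Representation k (Γ × (L ⧸ L'.subgroupOf L)) ((𝒢 ⧸ L') → V) :=
  MonoidHom.noncommCoprod (coeffRepresentation ι L' ρ) (levelTwistRep hle σ)
    (commute_coeffRepresentation_levelTwistRep ι hle ρ σ hc)

/-- Unfolding lemma for `levelProdTwistRep`. [folklore] -/
theorem levelProdTwistRep_apply (p : Γ × (L ⧸ L'.subgroupOf L)) (f : (𝒢 ⧸ L') → V) :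
    levelProdTwistRep ι hle ρ σ hc p f =
      coeffRepresentation ι L' ρ p.1 (levelTwistRep hle σ p.2 f) :=
  rfl

/-- Restricted to `Γ`, `levelProdTwistRep` is the twisted coefficient representation of level
`L'`. [folklore] -/
theorem levelProdTwistRep_inl (γ : Γ) :
    levelProdTwistRep ι hle ρ σ hc (MonoidHom.inl _ _ γ) = coeffRepresentation ι L' ρ γ :=
  DFunLike.congr_fun (MonoidHom.noncommCoprod_comp_inl _ _
    (commute_coeffRepresentation_levelTwistRep ι hle ρ σ hc)) γ

/-- Restricted to `L ⧸ L'`, `levelProdTwistRep` is the `σ`-twisted translation action.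
[folklore] -/
theorem levelProdTwistRep_inr (h : L ⧸ L'.subgroupOf L) :
    levelProdTwistRep ι hle ρ σ hc (MonoidHom.inr _ _ h) = levelTwistRep hle σ h :=
  DFunLike.congr_fun (MonoidHom.noncommCoprod_comp_inr _ _
    (commute_coeffRepresentation_levelTwistRep ι hle ρ σ hc)) h

/-- `W = Fun(𝒢 ⧸ L', V)` with `σ`-twisted values, as an object of `Rep k (Γ × (L ⧸ L'))`.
[folklore] -/
abbrev levelProdTwist : Rep k (Γ × (L ⧸ L'.subgroupOf L)) :=
  Rep.of (levelProdTwistRep ι hle ρ σ hc)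

/-- **`W|_Γ ≅ Fun(𝒢 ⧸ L', V)`**, the twisted coefficient representation of level `L'` (identity
on functions). [folklore] -/
def resFstTwistIso : resFst (levelProdTwist ι hle ρ σ hc) ≅ coeffRep ι L' ρ :=
  Rep.mkIso (Representation.Equiv.mk (LinearEquiv.refl k _) fun γ => LinearMap.ext fun f => by
    change levelProdTwistRep ι hle ρ σ hc (MonoidHom.inl _ _ γ) f = coeffRepresentation ι L' ρ γ f
    rw [levelProdTwistRep_inl])

/-- **`W|_{L/L'} ≅ Fun(𝒢 ⧸ L', V)` as the twisted function representation of the `L ⧸ L'`-set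
`𝒢 ⧸ L'` with coefficients `σ`** (identity on functions). [folklore] -/
def resSndTwistIso :
    letI := levelQuotAction hle
    resSnd (levelProdTwist ι hle ρ σ hc) ≅ twistedPi (𝒢 ⧸ L') (Rep.of σ) :=
  letI := levelQuotAction hle
  Rep.mkIso (Representation.Equiv.mk (LinearEquiv.refl k _) fun h =>
    LinearMap.ext fun f => funext fun c => by
      change levelProdTwistRep ι hle ρ σ hc (MonoidHom.inr _ _ h) f c = σ h (f (qsmul hle h⁻¹ c))
      rw [levelProdTwistRep_inr, levelTwistRep_apply])

/-- **`W^{L/L'}`**: a `0`-cochain `f` of `W` lies in `ker d⁰` iff its value is a function on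
`𝒢 ⧸ L'` with `σ(h) f(h⁻¹ ⋆ c) = f(c)` for all `h ∈ L ⧸ L'`. [folklore] -/
theorem mem_hKer_levelProdTwist_iff
    (f : (Fin 0 → L ⧸ L'.subgroupOf L) → (𝒢 ⧸ L') → V) :
    f ∈ (hd (levelProdTwist ι hle ρ σ hc) 0).hom.ker.toSubmodule ↔
      ∀ (x : Fin 0 → L ⧸ L'.subgroupOf L) (h : L ⧸ L'.subgroupOf L) (c : 𝒢 ⧸ L'),
        σ h (f x (qsmul hle h⁻¹ c)) = f x c := by
  constructor
  · intro hf x h c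
    have e := (mem_hKer_zero_iff (levelProdTwist ι hle ρ σ hc) f).1 hf h
    rw [Rep.of_ρ, levelProdTwistRep_inr] at e
    have e' := congrFun e c
    rw [levelTwistRep_apply] at e'
    convert e'
  · intro hf
    refine (mem_hKer_zero_iff (levelProdTwist ι hle ρ σ hc) f).2 fun h => ?_
    rw [Rep.of_ρ, levelProdTwistRep_inr]
    funext c
    rw [levelTwistRep_apply]
    exact hf _ h c

variable {g₀ : 𝒢} (hconj : ∀ l : L, ∃ a ∈ L', ∃ b ∈ L', (l : 𝒢) * g₀ * (l : 𝒢)⁻¹ = a * g₀ * b)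
  (hfin' : (ArithmeticQuotient.doubleCosetQuot L' g₀).Finite)

/-- **`[L' g₀ L']` as an endomorphism of `W`** (it commutes with the twisted `Γ`-action,
with the translations by `L ⧸ L'` — `heckeFun_comp_qsmul`, as soon as `l g₀ l⁻¹ ∈ L' g₀ L'` for
`l ∈ L` — and with `σ` acting on the values). [cite: ShimuraIATAF1971, Ch. 3, Prop. 3.1] -/
def heckeProdTwistHom : levelProdTwist ι hle ρ σ hc ⟶ levelProdTwist ι hle ρ σ hc :=
  Rep.ofHom (LinearMap.intertwiningMap_of_isIntertwiningMap _ _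
    (ArithmeticQuotient.heckeFun k L' g₀ V) fun p f => by
      rw [levelProdTwistRep_apply, levelProdTwistRep_apply, heckeFun_coeffRepresentation]
      congr 1
      change ArithmeticQuotient.heckeFun k L' g₀ V (σ p.2 ∘ (f ∘ qsmul hle p.2⁻¹)) =
        σ p.2 ∘ (ArithmeticQuotient.heckeFun k L' g₀ V f ∘ qsmul hle p.2⁻¹)
      rw [heckeFun_linearMap_comp, heckeFun_comp_qsmul hle hconj hfin'])

/-- Unfolding lemma for `heckeProdTwistHom`. [folklore] -/
@[simp]
theorem heckeProdTwistHom_hom_apply (f : (𝒢 ⧸ L') → V) :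
    (heckeProdTwistHom ι hle ρ σ hc hconj hfin').hom f =
      ArithmeticQuotient.heckeFun k L' g₀ V f :=
  rfl

/-- The endomorphism of the level-`L'` coefficients induced by an endomorphism `φ'` of `W`
(restrict to `Γ`, transport along `resFstTwistIso`: the same map on functions). [folklore] -/
def toLevelTwist' (φ' : levelProdTwist ι hle ρ σ hc ⟶ levelProdTwist ι hle ρ σ hc) :
    coeffRep ι L' ρ ⟶ coeffRep ι L' ρ :=
  (resFstTwistIso ι hle ρ σ hc).inv ≫ resFstMap (levelProdTwist ι hle ρ σ hc) φ' ≫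
    (resFstTwistIso ι hle ρ σ hc).hom

/-- `toLevelTwist' φ'` is `φ'` on functions. [folklore] -/
@[simp]
theorem toLevelTwist'_hom_apply (φ' : levelProdTwist ι hle ρ σ hc ⟶ levelProdTwist ι hle ρ σ hc)
    (f : (𝒢 ⧸ L') → V) : (toLevelTwist' ι hle ρ σ hc φ').hom f = φ'.hom f :=
  rfl

/-- **`toLevelTwist'` as a ring homomorphism `End(W) → End(Fun(𝒢 ⧸ L', V))`.** [folklore] -/
def toLevelTwist'RingHom : End (levelProdTwist ι hle ρ σ hc) →+* End (coeffRep ι L' ρ) where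
  toFun := toLevelTwist' ι hle ρ σ hc
  map_one' := Rep.hom_ext (Representation.IntertwiningMap.ext (LinearMap.ext fun _ => rfl))
  map_mul' _ _ := Rep.hom_ext (Representation.IntertwiningMap.ext (LinearMap.ext fun _ => rfl))
  map_zero' := Rep.hom_ext (Representation.IntertwiningMap.ext (LinearMap.ext fun _ => rfl))
  map_add' _ _ := Rep.hom_ext (Representation.IntertwiningMap.ext (LinearMap.ext fun _ => rfl))

/-- At level `L'`, `heckeProdTwistHom g₀` induces the Hecke operator `[L' g₀ L']`. [folklore] -/
theorem toLevelTwist'_heckeProdTwistHom :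
    toLevelTwist' ι hle ρ σ hc (heckeProdTwistHom ι hle ρ σ hc hconj hfin') =
      heckeRepHom ι L' ρ g₀ :=
  Rep.hom_ext (Representation.IntertwiningMap.ext (LinearMap.ext fun _ => rfl))

/-- The induced endomorphism `φZ _ φ' 0` of `W^{L/L'}` is `φ'` on values. [folklore] -/
theorem val_φZ_hom_apply (φ' : levelProdTwist ι hle ρ σ hc ⟶ levelProdTwist ι hle ρ σ hc)
    (F : hKerRep (levelProdTwist ι hle ρ σ hc) 0) (x : Fin 0 → L ⧸ L'.subgroupOf L) :
    ((φZ (levelProdTwist ι hle ρ σ hc) φ' 0).hom F).1 x = φ'.hom (F.1 x) :=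
  rfl

/-- **Level change is nilpotent-exact (values twisted by `σ`).**  Let `φ'` be an endomorphism of
`W = Fun(𝒢 ⧸ L', V) ∈ Rep k (Γ × (L ⧸ L'))` (e.g. a noncommutative polynomial in the
`heckeProdTwistHom g₀`, cf. `toLevelTwist'RingHom`, `toLevelTwist'_heckeProdTwistHom`).  If the
induced endomorphism of the level-`L'` coefficients acts as `0` on `Hᵇ(Γ, Fun(𝒢 ⧸ L', V))` for all
`b ≤ q`, then `H^q(Γ, φ')` acts on `H^q(Γ, W^{L/L'})` with `(q+1)`-st power zero — the
Hochschild–Serre reduction `Hⁱ(K/K', Hʲ(X_{K'}, ℳ/p^m)) ⇒ H^{i+j}(X_K, ℳ/p^m)` of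
[cite: Scholze2015, §V.4, proof of Thm. V.4.1] for stacky quotients of any level. -/
theorem pow_succ_map_φZ_levelProdTwist_eq_zero
    (φ' : levelProdTwist ι hle ρ σ hc ⟶ levelProdTwist ι hle ρ σ hc) (q : ℕ)
    (hφ : ∀ b ≤ q, groupCohomology.map (A := coeffRep ι L' ρ) (MonoidHom.id Γ)
      (toLevelTwist' ι hle ρ σ hc φ') b = 0) :
    (groupCohomology.map (A := hKerRep (levelProdTwist ι hle ρ σ hc) 0) (MonoidHom.id Γ)
      (φZ (levelProdTwist ι hle ρ σ hc) φ' 0) q).hom ^ (q + 1) = 0 := by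
  letI := levelQuotAction hle
  have hφ' : ∀ b ≤ q, groupCohomology.map (A := resFst (levelProdTwist ι hle ρ σ hc))
      (MonoidHom.id Γ) (resFstMap (levelProdTwist ι hle ρ σ hc) φ') b = 0 := by
    intro b hb
    have he : resFstMap (levelProdTwist ι hle ρ σ hc) φ' =
        (resFstTwistIso ι hle ρ σ hc).hom ≫ toLevelTwist' ι hle ρ σ hc φ' ≫
          (resFstTwistIso ι hle ρ σ hc).inv := by
      simp only [toLevelTwist', Category.assoc, Iso.hom_inv_id_assoc, Iso.hom_inv_id,
        Category.comp_id]
    rw [he, groupCohomology.map_id_comp, groupCohomology.map_id_comp, hφ b hb,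
      Limits.zero_comp, Limits.comp_zero]
  exact hsNilpotent_of_free (levelProdTwist ι hle ρ σ hc) φ'
    (fun h s hs => levelQuot_free hle h s hs) (Rep.of σ) (resSndTwistIso ι hle ρ σ hc) q hφ'

/-! #### Noncommutative polynomials in the Hecke operators -/

variable {I : Type*} (t : I → 𝒢)
  (hconjₜ : ∀ (i : I) (l : L), ∃ a ∈ L', ∃ b ∈ L', (l : 𝒢) * t i * (l : 𝒢)⁻¹ = a * t i * b)
  (hfinₜ : ∀ i : I, (ArithmeticQuotient.doubleCosetQuot L' (t i)).Finite)

omit hc in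
variable (L') in
/-- Evaluation of noncommutative polynomials over `ℤ` (elements of the free ring on `I`) at the
Hecke operators `[L' tᵢ L']` of level `L'`. [folklore] -/
def heckePoly : FreeRing I →+* End (coeffRep ι L' ρ) :=
  FreeRing.lift fun i => heckeRepHom ι L' ρ (t i)

omit hc in
/-- `heckePoly` on a generator. [folklore] -/
@[simp]
theorem heckePoly_of (i : I) : heckePoly ι L' ρ t (FreeRing.of i) = heckeRepHom ι L' ρ (t i) :=
  FreeRing.lift_of _ _

/-- Evaluation of noncommutative polynomials at the Hecke operators `[L' tᵢ L']` acting on `W`.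
[folklore] -/
def heckePolyTwist : FreeRing I →+* End (levelProdTwist ι hle ρ σ hc) :=
  FreeRing.lift fun i => heckeProdTwistHom ι hle ρ σ hc (hconjₜ i) (hfinₜ i)

/-- `heckePolyTwist` on a generator. [folklore] -/
@[simp]
theorem heckePolyTwist_of (i : I) :
    heckePolyTwist ι hle ρ σ hc t hconjₜ hfinₜ (FreeRing.of i) =
      heckeProdTwistHom ι hle ρ σ hc (hconjₜ i) (hfinₜ i) :=
  FreeRing.lift_of _ _

/-- A polynomial in the `[L' tᵢ L']` on `W` induces the same polynomial in the `[L' tᵢ L']` on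
the level-`L'` coefficients. [folklore] -/
theorem toLevelTwist'_heckePolyTwist (Q : FreeRing I) :
    toLevelTwist' ι hle ρ σ hc (heckePolyTwist ι hle ρ σ hc t hconjₜ hfinₜ Q) =
      heckePoly ι L' ρ t Q := by
  change ((toLevelTwist'RingHom ι hle ρ σ hc).comp (heckePolyTwist ι hle ρ σ hc t hconjₜ hfinₜ))
    Q = heckePoly ι L' ρ t Q
  refine DFunLike.congr_fun (FreeRing.hom_ext fun i => ?_) Q
  rw [RingHom.comp_apply, heckePolyTwist_of, heckePoly_of]
  exact toLevelTwist'_heckeProdTwistHom ι hle ρ σ hc (hconjₜ i) (hfinₜ i)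

/-- **Level change is nilpotent-exact, for polynomials in Hecke operators.**  If a noncommutative
polynomial `Q` in the Hecke operators `[L' tᵢ L']` (`l tᵢ l⁻¹ ∈ L' tᵢ L'` for `l ∈ L`) acts as `0`
on `Hᵇ(Γ, Fun(𝒢 ⧸ L', V))` for all `b ≤ q`, then `Q` evaluated on `W^{L/L'}` acts on
`H^q(Γ, W^{L/L'})` with `(q+1)`-st power zero. [cite: Scholze2015, §V.4, proof of Thm. V.4.1] -/
theorem pow_succ_map_φZ_heckePolyTwist_eq_zero (Q : FreeRing I) (q : ℕ)
    (hQ : ∀ b ≤ q, groupCohomology.map (A := coeffRep ι L' ρ) (MonoidHom.id Γ)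
      (heckePoly ι L' ρ t Q) b = 0) :
    (groupCohomology.map (A := hKerRep (levelProdTwist ι hle ρ σ hc) 0) (MonoidHom.id Γ)
      (φZ (levelProdTwist ι hle ρ σ hc) (heckePolyTwist ι hle ρ σ hc t hconjₜ hfinₜ Q) 0)
        q).hom ^ (q + 1) = 0 :=
  pow_succ_map_φZ_levelProdTwist_eq_zero ι hle ρ σ hc _ q fun b hb => by
    rw [toLevelTwist'_heckePolyTwist]
    exact hQ b hb

end Twist

end TwistedQuotient

end Literature.NumberTheory.Automorphic
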